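import Summits.ABC.IUTFork.Cor312LicenceShallowConcreteDatum
import HarnessLib

/-!
# [IUTchIII] Cor. 3.12 — the concrete inhabited-side pilot datum WITH `√−1` in the base field ([IUTchI] Def. 3.1 (a)), part 1:
# `F = ℚ(⁵√7, √−1)`, `j_E = 7⁻²`, `S = V(F)₇`, `l = 5`

Definition-bearing instance file of the abc-iut cell (block C / W6 cone prover abc-iut-w6-d114, gen 4; row
«LICENCE-SHALLOW-CONCRETE-DATUM-SQRT-NEG-ONE», the repair asked for by the RQ7 second read of this seat's
`Cor312LicenceShallowConcreteDatum` (p441984) — abc-iut-w6-d091, HOME/STATUS 2026-08-26T11:43:14Z: «`F75 ⊂ ℝ ⇒ √−1 ∉ F75 ⇒ [IUTchI]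
Def 3.1 (a) EXCLUDES F75 as the F of any initial Θ-datum … cheap repair ℚ(⁵√7, √−1): 7 inert in ℚ(i) ⇒ one place over 7 with
e = 5, f = 2, tame, P_q = 1, (l⋇)²·1 = 4 < 6, deĝ̲ = ln 7/5 unchanged»). TAKES NO SIDE on [IUTchIII] Cor. 3.12 or on any author.
The compositions with abc-iut-w5-d236's `Cor312LicenceShallowRealising` (p439445) live in the proof-only sequel
`Cor312LicenceShallowConcreteDatumSqrtNegOneLicence`.

[IUTchI] Def. 3.1 (a) asks the number field `F` of an initial Θ-datum to contain `√−1`; the datum `X75` of p441984 lives over the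
REAL field `ℚ(⁵√7)`, so it is a PilotData-level inhabitant that no initial Θ-datum can have as its `(F, …)`. THIS FILE builds the
variant over the (non-real) field `F75i = ℚ(⁵√7, √−1) ⊆ ℂ` and discharges the two arithmetic binders `htame`, `hdeg` of p439445
there, again with no Kummer–Dedekind computation:

* §1 `F75i := ℚ⟮⁵√7⟯ ⊔ ℚ⟮i⟯ ⊆ ℂ` — a number field with `[F75i : ℚ] ≤ 5·2 = 10` (`IntermediateField.finrank_sup_le`; the minimal
  polynomials `X⁵ − 7`, p441984's `irreducible_X_pow_five_sub_seven`, and `X² + 1`); algebraic integers `aO = ⁵√7` (`aO⁵ = 7`) and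
  `iO = √−1` (`iO² = −1`); **`exists_sq_eq_neg_one`**: `√−1 ∈ F75i` (Def. 3.1 (a)'s clause, at the base-field level).
* §2 EVERY place `v ∣ 7` of `F75i` has `p_v = 7`, **`e_v = 5`, `f_v = 2`** (so — in the sequel — there is exactly one and
  `[F75i : ℚ] = 10`), and `v` is TAME (`2 < 7`, `5 ≤ 7 − 2`): `⁵√7 ∈ v` gives `e_v = 5·ord_v(⁵√7) ≥ 5` (`Cor22.ord_natCast_eq_ramIdx`); **`f_v ≥ 2` because `−1` is a
  square in the residue field `𝒪/v ∋ iO mod v` but not in a field with `7` elements** (`x⁷ = x`, `x⁶ = (x²)³ = −1`); and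
  `e_v f_v ≤ Σ_{w ∣ 7} e_w f_w = [F75i : ℚ] ≤ 10` (`sum_localDegree`).
* §3 the pilot datum **`X75i : PilotData F75i := ⟨j_E := 7⁻², S := V(F75i)₇, l := 5⟩`** (`ord_v(j_E) = −10 < 0`): `ord_v(q_v) = 10 = 2l`
  (`Cor312Prov.TwoMulLDvdOrdq X75i`: realising Θ- and q-ideles EXIST), `P_q(v) = 1`, `l⋇ = 2`, so **`htame_X75i`, `hdeg_X75i`**
  (`4·1 < 5 + 1`); the degrees `deĝ(P_q) = 2 ln 7`, `deĝ̲(P_q) = (ln 7)/5` are computed in the sequel.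

READING (neutral; numbers, not adjectives). This removes ONE named obstruction to genuineness (Def. 3.1 (a)'s `√−1 ∈ F`) from the
inhabited-side concrete datum; it is STILL a PilotData-level inhabitant only — no elliptic curve, no `K = F(E[l])`, no claim that an
initial Θ-datum realises it (abc-iut-C-cert-3 v5K). [folklore] number theory ([cite: NeukirchANT1999, Ch. I §8 Prop. (8.2)] for
`Σ e f = n`); [cite: DupuyHilado2025, §2.5.4, §3.3, §3.4]; [cite: Mochizuki2012, IUTchI Def. 3.1 (a) p. 61, Ex. 3.2 (iv) p. 71];
[claim: Mochizuki2012, status: disputed] for every IUT sentence quoted. typed ≠ proved; instantiated ≠ endorsed.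
-/

noncomputable section

namespace Summit.ABC.IUTFork.ConcreteDatumSqrtNegOne

open Polynomial IntermediateField NumberField IsDedekindDomain
open Literature.IUT.LogVolume
open Summit.ABC.IUTFork.ConcreteDatum (rt rt_pos rt_pow rt_isIntegral_rat minpoly_rt irreducible_X_pow_five_sub_seven)

/-! ## §1. The field `F75i = ℚ(⁵√7, √−1) ⊆ ℂ` -/

/-- `⁵√7 ∈ ℂ` (the real fifth root, embedded). [folklore] -/
def α : ℂ := (rt : ℂ)

/-- `(⁵√7)⁵ = 7` in `ℂ`. [folklore] -/
theorem α_pow : α ^ 5 = 7 := by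
  rw [α, ← Complex.ofReal_pow, rt_pow]
  norm_num

/-- `⁵√7 ≠ 0` in `ℂ`. [folklore] -/
theorem α_ne_zero : α ≠ 0 := by
  rw [α, Ne, Complex.ofReal_eq_zero]
  exact ne_of_gt rt_pos

/-- `⁵√7 ∈ ℂ` is integral over `ℚ`. [folklore] -/
theorem α_isIntegral_rat : IsIntegral ℚ α := by
  refine ⟨X ^ 5 - C (7 : ℚ), monic_X_pow_sub_C _ (by norm_num), ?_⟩
  simp [α_pow]

/-- The minimal polynomial of `⁵√7 ∈ ℂ` over `ℚ` is `X⁵ − 7`. [folklore] -/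
theorem minpoly_α : minpoly ℚ α = X ^ 5 - C (7 : ℚ) := by
  refine (minpoly.eq_of_irreducible_of_monic irreducible_X_pow_five_sub_seven ?_ (monic_X_pow_sub_C _ (by norm_num))).symm
  simp [α_pow]

/-- `[ℚ(⁵√7) : ℚ] = 5` (inside `ℂ`). [folklore] -/
theorem finrank_adjoin_α : Module.finrank ℚ ↥ℚ⟮α⟯ = 5 := by
  rw [IntermediateField.adjoin.finrank α_isIntegral_rat, minpoly_α]
  compute_degree!

/-- `√−1 ∈ ℂ` is integral over `ℚ`. [folklore] -/
theorem I_isIntegral_rat : IsIntegral ℚ Complex.I := by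
  refine ⟨X ^ 2 - C (-1 : ℚ), monic_X_pow_sub_C _ (by norm_num), ?_⟩
  simp

/-- `−1` is not the square of a rational. [folklore] -/
theorem sq_ne_neg_one (b : ℚ) : b ^ 2 ≠ -1 := fun h => by nlinarith [sq_nonneg b]

/-- `X² + 1 = X² − (−1)` is irreducible over `ℚ`. [folklore] -/
theorem irreducible_X_sq_sub_C_neg_one : Irreducible (X ^ 2 - C (-1 : ℚ)) :=
  X_pow_sub_C_irreducible_of_prime Nat.prime_two fun b => sq_ne_neg_one b

/-- The minimal polynomial of `√−1` over `ℚ` is `X² − (−1)`. [folklore] -/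
theorem minpoly_I : minpoly ℚ Complex.I = X ^ 2 - C (-1 : ℚ) := by
  refine (minpoly.eq_of_irreducible_of_monic irreducible_X_sq_sub_C_neg_one ?_ (monic_X_pow_sub_C _ (by norm_num))).symm
  simp

/-- `[ℚ(√−1) : ℚ] = 2` (inside `ℂ`). [folklore] -/
theorem finrank_adjoin_I : Module.finrank ℚ ↥ℚ⟮Complex.I⟯ = 2 := by
  rw [IntermediateField.adjoin.finrank I_isIntegral_rat, minpoly_I]
  compute_degree!

/-- **The field `F75i = ℚ(⁵√7, √−1)`**, as the compositum `ℚ⟮⁵√7⟯ ⊔ ℚ⟮√−1⟯ ⊆ ℂ`. [folklore] -/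
def F75i : IntermediateField ℚ ℂ := ℚ⟮α⟯ ⊔ ℚ⟮Complex.I⟯

/-- `ℚ(⁵√7) ⊆ ℂ` is finite over `ℚ`. [folklore] -/
instance finiteDimensional_adjoin_α : FiniteDimensional ℚ ↥ℚ⟮α⟯ :=
  IntermediateField.adjoin.finiteDimensional α_isIntegral_rat

/-- `ℚ(√−1) ⊆ ℂ` is finite over `ℚ`. [folklore] -/
instance finiteDimensional_adjoin_I : FiniteDimensional ℚ ↥ℚ⟮Complex.I⟯ :=
  IntermediateField.adjoin.finiteDimensional I_isIntegral_rat

/-- `F75i` is finite over `ℚ`. [folklore] -/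
instance finiteDimensional_F75i : FiniteDimensional ℚ ↥F75i := by
  unfold F75i
  infer_instance

/-- `F75i` is a number field. [folklore] -/
instance numberField_F75i : NumberField ↥F75i where

/-- **`[F75i : ℚ] ≤ 10`** (`≤ [ℚ(⁵√7):ℚ]·[ℚ(√−1):ℚ] = 5·2`). [folklore] -/
theorem finrank_F75i_le : Module.finrank ℚ ↥F75i ≤ 10 := by
  have h := IntermediateField.finrank_sup_le ℚ⟮α⟯ ℚ⟮Complex.I⟯
  rw [finrank_adjoin_α, finrank_adjoin_I] at h
  exact h

/-- `⁵√7 ∈ F75i`. [folklore] -/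
theorem α_mem : α ∈ F75i :=
  (le_sup_left : ℚ⟮α⟯ ≤ F75i) (mem_adjoin_simple_self ℚ α)

/-- `√−1 ∈ F75i`. [folklore] -/
theorem I_mem : Complex.I ∈ F75i :=
  (le_sup_right : ℚ⟮Complex.I⟯ ≤ F75i) (mem_adjoin_simple_self ℚ Complex.I)

/-- `⁵√7` as an element of `F75i`. [folklore] -/
def a : ↥F75i := ⟨α, α_mem⟩

/-- `√−1` as an element of `F75i`. [folklore] -/
def i : ↥F75i := ⟨Complex.I, I_mem⟩

/-- `a⁵ = 7`. [folklore] -/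
theorem a_pow : a ^ 5 = 7 := by
  apply Subtype.ext
  show α ^ 5 = (7 : ℂ)
  exact α_pow

/-- `a ≠ 0`. [folklore] -/
theorem a_ne_zero : a ≠ 0 := fun h => α_ne_zero (congrArg Subtype.val h)

/-- `i² = −1`. [folklore] -/
theorem i_sq : i ^ 2 = -1 := by
  apply Subtype.ext
  show Complex.I ^ 2 = (-1 : ℂ)
  exact Complex.I_sq

/-- **[IUTchI] Def. 3.1 (a)'s clause at the base-field level: `√−1 ∈ F75i`.** [cite: Mochizuki2012, IUTchI Def. 3.1 (a) p. 61] -/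
theorem exists_sq_eq_neg_one : ∃ x : ↥F75i, x ^ 2 = -1 := ⟨i, i_sq⟩

/-- `a` is integral over `ℤ`. [folklore] -/
theorem a_isIntegral : IsIntegral ℤ a := by
  refine ⟨X ^ 5 - C (7 : ℤ), monic_X_pow_sub_C _ (by norm_num), ?_⟩
  have := a_pow
  simp only [eval₂_sub, eval₂_X_pow, eval₂_C]
  rw [show ((algebraMap ℤ ↥F75i) 7) = (7 : ↥F75i) from map_ofNat _ 7, this]
  ring

/-- `i` is integral over `ℤ`. [folklore] -/
theorem i_isIntegral : IsIntegral ℤ i := by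
  refine ⟨X ^ 2 + 1, monic_X_pow_add_C _ (by norm_num), ?_⟩
  have := i_sq
  simp only [eval₂_add, eval₂_X_pow, eval₂_one]
  rw [this]
  ring

/-- `⁵√7` as an algebraic integer of `F75i`. [folklore] -/
def aO : 𝓞 ↥F75i := ⟨a, a_isIntegral⟩

/-- `√−1` as an algebraic integer of `F75i`. [folklore] -/
def iO : 𝓞 ↥F75i := ⟨i, i_isIntegral⟩

/-- `aO` maps to `a`. [folklore] -/
theorem algebraMap_aO : algebraMap (𝓞 ↥F75i) ↥F75i aO = a := rfl

/-- `aO ≠ 0`. [folklore] -/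
theorem aO_ne_zero : aO ≠ 0 := by
  intro h
  apply a_ne_zero
  rw [← algebraMap_aO, h, map_zero]

/-- `aO⁵ = 7` in `𝒪_{F75i}`. [folklore] -/
theorem aO_pow : aO ^ 5 = 7 := by
  apply RingOfIntegers.coe_injective
  show algebraMap (𝓞 ↥F75i) ↥F75i (aO ^ 5) = algebraMap (𝓞 ↥F75i) ↥F75i 7
  rw [map_pow, algebraMap_aO, a_pow, map_ofNat]

/-- `iO² = −1` in `𝒪_{F75i}`. [folklore] -/
theorem iO_sq : iO ^ 2 = -1 := by
  apply RingOfIntegers.coe_injective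
  show algebraMap (𝓞 ↥F75i) ↥F75i (iO ^ 2) = algebraMap (𝓞 ↥F75i) ↥F75i (-1)
  rw [map_pow, map_neg, map_one]
  exact i_sq

/-! ## §2. Every place over `7`: `e = 5` (via `⁵√7`), `f = 2` (via `√−1`), exactly one; tame -/

/-- `7` is prime (instance for `placesOver F75i 7`). [folklore] -/
instance fact_prime_seven : Fact (Nat.Prime 7) := ⟨by norm_num⟩

/-- A place of `F75i` over `7` contains `7`. [folklore] -/
theorem seven_mem_of_mem_placesOver {v : HeightOneSpectrum (𝓞 ↥F75i)} (hv : v ∈ placesOver ↥F75i 7) :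
    ((7 : ℕ) : 𝓞 ↥F75i) ∈ v.asIdeal := by
  have h := (mem_placesOver_iff v).mp hv
  have hmem : ((7 : ℕ) : ℤ) ∈ v.asIdeal.under ℤ := by
    rw [← h.over]; exact Ideal.mem_span_singleton_self _
  simpa using Ideal.mem_comap.mp hmem

/-- A place of `F75i` over `7` contains `⁵√7`. [folklore] -/
theorem aO_mem_of_mem_placesOver {v : HeightOneSpectrum (𝓞 ↥F75i)} (hv : v ∈ placesOver ↥F75i 7) :
    aO ∈ v.asIdeal := by
  have h7 : aO ^ 5 ∈ v.asIdeal := by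
    rw [aO_pow]
    exact_mod_cast seven_mem_of_mem_placesOver hv
  exact v.isPrime.mem_of_pow_mem 5 h7

/-- The residue characteristic of a place of `F75i` over `7` is `7`. [folklore] -/
theorem residueChar_of_mem_placesOver {v : HeightOneSpectrum (𝓞 ↥F75i)} (hv : v ∈ placesOver ↥F75i 7) :
    residueChar ↥F75i v = 7 :=
  (mem_placesOver_iff_residueChar v).mp hv

/-- **`e_v ≥ 5`** at a place over `7`: `e_v = ord_v(7) = 5·ord_v(⁵√7)`, `ord_v(⁵√7) ≥ 1`. [folklore] -/
theorem five_le_ramIdx_of_mem_placesOver {v : HeightOneSpectrum (𝓞 ↥F75i)} (hv : v ∈ placesOver ↥F75i 7) :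
    5 ≤ ramIdx ↥F75i v := by
  have h7 : ord ↥F75i v ((7 : ℕ) : ↥F75i) = ramIdx ↥F75i v := Cor22.ord_natCast_eq_ramIdx 7 v hv
  have hr : ((7 : ℕ) : ↥F75i) = (a : ↥F75i) ^ 5 := by
    push_cast
    exact a_pow.symm
  rw [hr, ord_pow] at h7
  have hpos : 0 < ord ↥F75i v (a : ↥F75i) := by
    rw [← algebraMap_aO]
    exact (ord_pos_iff_mem (↥F75i) v aO aO_ne_zero).mpr (aO_mem_of_mem_placesOver hv)
  push_cast at h7
  have h5 : (5 : ℤ) ≤ (ramIdx ↥F75i v : ℤ) := by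
    rw [← h7]
    linarith
  exact_mod_cast h5

/-- **In a field with `7` elements `−1` is not a square** (`x⁷ = x`, so `x⁶ = 1` for `x ≠ 0`, while `(x²)³ = −1`; and
`−1 ≠ 1` in characteristic `7`). [folklore] -/
theorem sq_ne_neg_one_of_card_seven {k : Type*} [Field k] [Fintype k] (hk : Fintype.card k = 7) (x : k) : x ^ 2 ≠ -1 := by
  intro h
  have h7 : x ^ 7 = x := by rw [← hk]; exact FiniteField.pow_card x
  have hx0 : x ≠ 0 := by
    rintro rfl
    norm_num at h
  have h6 : x ^ 6 = 1 := by
    have : x * (x ^ 6 - 1) = 0 := by rw [mul_sub, mul_one, ← pow_succ', h7]; ring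
    rcases mul_eq_zero.mp this with h0 | h1
    · exact absurd h0 hx0
    · exact sub_eq_zero.mp h1
  have h6' : x ^ 6 = -1 := by
    rw [show x ^ 6 = (x ^ 2) ^ 3 by ring, h]
    norm_num
  have hc : ((7 : ℕ) : k) = 0 := by rw [← hk]; exact FiniteField.cast_card_eq_zero k
  have h2 : (2 : k) = 0 := by
    have := h6.symm.trans h6'
    linear_combination this
  have h1 : (1 : k) = 0 := by
    have : (1 : k) = (7 : ℕ) - 3 * 2 := by norm_num
    rw [this, hc, h2]; ring
  exact one_ne_zero h1

/-- **`f_v ≥ 2`** at a place of `F75i` over `7`: were `f_v = 1`, the residue field `𝒪/v` would have `7` elements and contain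
the square root `iO mod v` of `−1`. [folklore] -/
theorem two_le_resDeg_of_mem_placesOver {v : HeightOneSpectrum (𝓞 ↥F75i)} (hv : v ∈ placesOver ↥F75i 7) :
    2 ≤ resDeg ↥F75i v := by
  by_contra hlt
  have hf0 : resDeg ↥F75i v ≠ 0 := resDeg_ne_zero ↥F75i v
  have hf1 : resDeg ↥F75i v = 1 := by omega
  -- the residue field has `7` elements
  have hcard : Nat.card (𝓞 ↥F75i ⧸ v.asIdeal) = 7 := by
    rw [← Submodule.cardQuot_apply, ← Ideal.absNorm_apply, absNorm_eq, residueChar_of_mem_placesOver hv, hf1, pow_one]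
  haveI : Finite (𝓞 ↥F75i ⧸ v.asIdeal) := Nat.finite_of_card_ne_zero (by rw [hcard]; norm_num)
  letI : Fintype (𝓞 ↥F75i ⧸ v.asIdeal) := Fintype.ofFinite _
  haveI : v.asIdeal.IsMaximal := v.isMaximal
  letI : Field (𝓞 ↥F75i ⧸ v.asIdeal) := Ideal.Quotient.field v.asIdeal
  have hk : Fintype.card (𝓞 ↥F75i ⧸ v.asIdeal) = 7 := by rw [← Nat.card_eq_fintype_card, hcard]
  have hsq : (Ideal.Quotient.mk v.asIdeal iO) ^ 2 = -1 := by
    rw [← map_pow, iO_sq, map_neg, map_one]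
  exact sq_ne_neg_one_of_card_seven hk _ hsq

/-- **`n_v = e_v f_v ≤ 10`** at a place over `7` (`≤ Σ_{w ∣ 7} e_w f_w = [F75i : ℚ] ≤ 10`). [cite: NeukirchANT1999, Ch. I §8 Prop. (8.2)] -/
theorem localDegree_le_ten_of_mem_placesOver {v : HeightOneSpectrum (𝓞 ↥F75i)} (hv : v ∈ placesOver ↥F75i 7) :
    localDegree ↥F75i v ≤ 10 := by
  have hle : localDegree ↥F75i v ≤ ∑ w ∈ placesOver ↥F75i 7, localDegree ↥F75i w :=
    Finset.single_le_sum (fun w _ => Nat.zero_le (localDegree ↥F75i w)) hv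
  rw [sum_localDegree] at hle
  exact hle.trans finrank_F75i_le

/-- **`e_v = 5`** at every place of `ℚ(⁵√7, √−1)` over `7` (`5 ≤ e_v`, `2 ≤ f_v`, `e_v f_v ≤ 10`). [folklore] -/
theorem ramIdx_of_mem_placesOver {v : HeightOneSpectrum (𝓞 ↥F75i)} (hv : v ∈ placesOver ↥F75i 7) :
    ramIdx ↥F75i v = 5 := by
  have h5 := five_le_ramIdx_of_mem_placesOver hv
  have h2 := two_le_resDeg_of_mem_placesOver hv
  have h10 := localDegree_le_ten_of_mem_placesOver hv
  unfold localDegree at h10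
  nlinarith

/-- **`f_v = 2`** at every place of `ℚ(⁵√7, √−1)` over `7` («`7` is inert in `ℚ(√−1)`»). [folklore] -/
theorem resDeg_of_mem_placesOver {v : HeightOneSpectrum (𝓞 ↥F75i)} (hv : v ∈ placesOver ↥F75i 7) :
    resDeg ↥F75i v = 2 := by
  have h2 := two_le_resDeg_of_mem_placesOver hv
  have h10 := localDegree_le_ten_of_mem_placesOver hv
  unfold localDegree at h10
  rw [ramIdx_of_mem_placesOver hv] at h10
  omega

/-- **Tameness**: a place of `F75i` over `7` has `p_v = 7 > 2` and `e_v = 5 ≤ 7 − 2`. [folklore] -/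
theorem tame_of_mem_placesOver {v : HeightOneSpectrum (𝓞 ↥F75i)} (hv : v ∈ placesOver ↥F75i 7) :
    2 < residueChar ↥F75i v ∧ ramIdx ↥F75i v ≤ residueChar ↥F75i v - 2 := by
  rw [residueChar_of_mem_placesOver hv, ramIdx_of_mem_placesOver hv]
  norm_num

/-! ## §3. The pilot datum `X75i = (F75i, j_E = 7⁻², S = V(F75i)₇, l = 5)` -/

/-- `ord_v(7⁻²) = −10` at a place over `7`. [folklore] -/
theorem ord_jE_of_mem_placesOver {v : HeightOneSpectrum (𝓞 ↥F75i)} (hv : v ∈ placesOver ↥F75i 7) :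
    ord ↥F75i v (((7 : ↥F75i)⁻¹) ^ 2) = -10 := by
  have h7 : ord ↥F75i v ((7 : ℕ) : ↥F75i) = ramIdx ↥F75i v := Cor22.ord_natCast_eq_ramIdx 7 v hv
  rw [ramIdx_of_mem_placesOver hv] at h7
  push_cast at h7
  rw [ord_pow, ord_inv, h7]
  norm_num

/-- **The concrete pilot datum `X75i`**: `F = ℚ(⁵√7, √−1)`, `j_E = 7⁻²`, `S = V(F)₇` (one place, `e = 5`, `f = 2`), `l = 5`.
[cite: DupuyHilado2025, §3.3] -/
def X75i : PilotData ↥F75i where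
  jE := ((7 : ↥F75i)⁻¹) ^ 2
  S := placesOver ↥F75i 7
  S_nonempty := placesOver_nonempty ↥F75i 7
  ord_jE_neg v hv := by
    rw [ord_jE_of_mem_placesOver hv]
    norm_num
  l := 5
  l_prime := by norm_num
  five_le_l := le_rfl

/-- `X75i.S = V(F75i)₇`. [cite: DupuyHilado2025, §3.3] -/
theorem X75i_S : X75i.S = placesOver ↥F75i 7 := rfl

/-- `X75i.l = 5`. [cite: DupuyHilado2025, §3.3] -/
theorem X75i_l : X75i.l = 5 := rfl

/-- `l⋇ = 2` for `X75i`. [cite: DupuyHilado2025, §3.3] -/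
theorem X75i_lstar : X75i.lstar = 2 := rfl

/-- `ord_v(q_v) = 10` at every bad place of `X75i`. [cite: DupuyHilado2025, §3.2–3.3] -/
theorem X75i_ordq {v : HeightOneSpectrum (𝓞 ↥F75i)} (hv : v ∈ X75i.S) : X75i.ordq v = 10 := by
  unfold PilotData.ordq
  rw [show X75i.jE = ((7 : ↥F75i)⁻¹) ^ 2 from rfl, ord_jE_of_mem_placesOver hv]
  norm_num

/-- **`2l ∣ ord_v(q_v)` on `S`**: realising Θ- and q-ideles exist at `X75i` (`Cor312Prov.exists_realising_…`).
[cite: Mochizuki2012, IUTchI Ex. 3.2 (iv) p. 71] -/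
theorem twoMulLDvdOrdq_X75i : Cor312Prov.TwoMulLDvdOrdq X75i := by
  intro w hw
  rw [X75i_ordq hw, X75i_l]
  norm_num

/-- `P_q(v) = 1` at every bad place of `X75i`. [cite: DupuyHilado2025, §3.3] -/
theorem X75i_qPilot {v : HeightOneSpectrum (𝓞 ↥F75i)} (hv : v ∈ X75i.S) : X75i.qPilot v = 1 := by
  rw [X75i.qPilot_apply_of_mem hv, X75i_ordq hv, X75i_l]
  norm_num

/-- **The tameness binder `htame` of abc-iut-w5-d236's theorem, DISCHARGED at `X75i`.** [folklore] -/
theorem htame_X75i : ∀ v ∈ X75i.S, 2 < residueChar ↥F75i v ∧ ramIdx ↥F75i v ≤ residueChar ↥F75i v - 2 :=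
  fun _ hv => tame_of_mem_placesOver hv

/-- **The degree-locus binder `hdeg` of abc-iut-w5-d236's theorem, DISCHARGED at `X75i`** (`1 ≤ 1`, `4·1 < 5 + 1`).
[cite: DupuyHilado2025, §3.3–3.4] -/
theorem hdeg_X75i :
    ∀ v ∈ X75i.S, 1 ≤ X75i.qPilot v ∧ ((X75i.lstar : ℕ) : ℝ) ^ 2 * X75i.qPilot v < (ramIdx ↥F75i v : ℝ) + 1 := by
  intro v hv
  rw [X75i_qPilot hv, X75i_lstar, ramIdx_of_mem_placesOver hv]
  norm_num

end Summit.ABC.IUTFork.ConcreteDatumSqrtNegOne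

end
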